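import Summits.CriticalPhenomena.PercolationContinuityZ3.Theorems.PercNearOneGluingNoHeavyLowerTailSahiE3LroSlot
import Mathlib.Order.Fin.Tuple
import Mathlib.Tactic.Linarith
import HarnessLib
import HarnessLib.Audit

/-!
# `NoHeavyLowerTail` (crux stmt-CriticalPhenomena-4575), Sahi programme P4: linear read-once steps OVER AN ARBITRARY CERTIFIED BASE

Support file (cell `prim-l12`, seat P4, generation 12; `--supports stmt-CriticalPhenomena-4575`).  No named facts, no sorries;
standard axioms; def-free.

THEOREM `cert_lro_over`.  Let `Q` be a finite poset with a weight `ν_Q ≥ 0` satisfying Harris' inequality for up-sets and an up-set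
slot `G ⊆ Q` carrying a flow certificate with exact deliveries (the six conditions of `…SahiE3PatternCertificate`, (K) with equality).
Then for every `n`, operators `ops : Fin n → Bool` and layer weights `w : Fin n → Bool → ℝ≥0`, the slot
`{(x, q) | x₀ ∘₀ (x₁ ∘₁ (⋯ ∘ₙ₋₁ [q ∈ G]))}` of `(Fin n → Bool) × Q` (`∘ᵢ = ∨` iff `ops i`) with the weight `(∏ᵢ wᵢ(xᵢ))·ν_Q(q)` is an
up-set, its weight satisfies Harris, and it carries a flow certificate with exact deliveries — by iterating the OR-steps and AND-steps of
generation 11 (`…SahiE3LroOrStep.cert_or_step`, `…SahiE3LroAndStep.cert_and_step`) over the base and transporting along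
`(Fin (n+1) → Bool) × Q ≃o Bool × ((Fin n → Bool) × Q)`.  With `Q` a point this is `…SahiE3LroSlot.cert_lro`; with `Q` the pattern of
`(y₁∧…∧y_a) ∨ (z₁∧…∧z_b)` (`…SahiE3DnfTwoSlot.cert_dnf_two_cube`) it gives every linear read-once formula whose innermost block is an OR
of two disjoint conjunctions (file `…SahiE3LroOverDnf`).
-/

namespace Summit.CriticalPhenomena.PercolationContinuityZ3.Theorems.SahiE3LroOverBase

open Finset SahiE3LroLayers SahiE3LroOrStep SahiE3LroAndStep SahiE3LroTransport
open scoped BigOperators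

variable {Q : Type*} [Fintype Q] [DecidableEq Q] [PartialOrder Q]

/-- **Linear read-once steps over a certified base.**  See the module docstring. [this work] -/
theorem cert_lro_over {νQ : Q → ℝ} (hνQ : ∀ q, 0 ≤ νQ q)
    (hHQ : ∀ S S' : Finset Q, IsUpperSet (S : Set Q) → IsUpperSet (S' : Set Q) →
      (∑ t ∈ S, νQ t) * (∑ t ∈ S', νQ t) ≤ (∑ t, νQ t) * ∑ t ∈ S ∩ S', νQ t)
    (G : Finset Q) (hG : IsUpperSet (G : Set Q)) (RQ : Q → ℝ) (FlQ : Q → Q → ℝ)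
    (g1 : ∀ t ∈ G, 0 ≤ RQ t) (g2 : ∀ t s, 0 ≤ FlQ t s) (g3 : ∀ t s, FlQ t s ≠ 0 → s ≤ t)
    (g4 : ∀ t ∈ G, RQ t + ∑ s ∈ Gᶜ, FlQ t s ≤ (∑ r, νQ r) * ((∑ r, νQ r) + ∑ r ∈ Gᶜ, νQ r) * νQ t)
    (g5 : ∀ s ∈ Gᶜ, ∑ t ∈ G, FlQ t s = (∑ r, νQ r) * (∑ r ∈ G, νQ r) * νQ s)
    (g6 : ∀ S S' : Finset Q, IsUpperSet (S : Set Q) → IsUpperSet (S' : Set Q) →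
      (∑ r, νQ r) * ((∑ t ∈ S, νQ t) * (∑ t ∈ S' ∩ G, νQ t) + (∑ t ∈ S', νQ t) * (∑ t ∈ S ∩ G, νQ t))
          - (∑ r ∈ G, νQ r) * (∑ t ∈ S, νQ t) * (∑ t ∈ S', νQ t) ≤ ∑ t ∈ (S ∩ S') ∩ G, RQ t) :
    ∀ (n : ℕ) (ops : Fin n → Bool) (w : Fin n → Bool → ℝ) (_hw : ∀ i b, 0 ≤ w i b)
      (ν : (Fin n → Bool) × Q → ℝ) (_hν : ∀ x, ν x = (∏ i, w i (x.1 i)) * νQ x.2)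
      (U : Finset ((Fin n → Bool) × Q))
      (_hU : ∀ x, x ∈ U ↔ Fin.foldr n (fun i b => bif ops i then (x.1 i || b) else (x.1 i && b)) (decide (x.2 ∈ G)) = true),
    IsUpperSet (U : Set ((Fin n → Bool) × Q)) ∧
    (∀ S S' : Finset ((Fin n → Bool) × Q), IsUpperSet (S : Set ((Fin n → Bool) × Q)) →
      IsUpperSet (S' : Set ((Fin n → Bool) × Q)) →
      (∑ t ∈ S, ν t) * (∑ t ∈ S', ν t) ≤ (∑ t, ν t) * ∑ t ∈ S ∩ S', ν t) ∧
    ∃ (R : (Fin n → Bool) × Q → ℝ) (Fl : ((Fin n → Bool) × Q) → ((Fin n → Bool) × Q) → ℝ),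
      (∀ t ∈ U, 0 ≤ R t) ∧ (∀ t s, 0 ≤ Fl t s) ∧ (∀ t s, Fl t s ≠ 0 → s ≤ t) ∧
      (∀ t ∈ U, R t + ∑ s ∈ Uᶜ, Fl t s ≤ (∑ r, ν r) * ((∑ r, ν r) + ∑ r ∈ Uᶜ, ν r) * ν t) ∧
      (∀ s ∈ Uᶜ, ∑ t ∈ U, Fl t s = (∑ r, ν r) * (∑ r ∈ U, ν r) * ν s) ∧
      (∀ S S' : Finset ((Fin n → Bool) × Q), IsUpperSet (S : Set ((Fin n → Bool) × Q)) →
        IsUpperSet (S' : Set ((Fin n → Bool) × Q)) →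
        (∑ r, ν r) * ((∑ t ∈ S, ν t) * (∑ t ∈ S' ∩ U, ν t) + (∑ t ∈ S', ν t) * (∑ t ∈ S ∩ U, ν t))
          - (∑ r ∈ U, ν r) * (∑ t ∈ S, ν t) * (∑ t ∈ S', ν t) ≤ ∑ t ∈ (S ∩ S') ∩ U, R t) := by
  intro n
  induction n with
  | zero =>
    intro ops w hw ν hν U hU
    -- `(Fin 0 → Bool) × Q ≃o Q`
    let e : Q ≃o ((Fin 0 → Bool) × Q) :=
      { toFun := fun q => (fun i => Fin.elim0 i, q)
        invFun := fun x => x.2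
        left_inv := fun q => rfl
        right_inv := fun x => by
          rcases x with ⟨f, q⟩
          simp only [Prod.mk.injEq, and_true]
          funext i; exact Fin.elim0 i
        map_rel_iff' := by
          intro q q'
          constructor
          · intro h; exact h.2
          · intro h; exact ⟨fun i => Fin.elim0 i, h⟩ }
    have hes : ∀ x : (Fin 0 → Bool) × Q, e.symm x = x.2 := fun x => rfl
    have hνe : ∀ x : (Fin 0 → Bool) × Q, ν x = νQ (e.symm x) := fun x => by
      rw [hes, hν, Finset.univ_eq_empty, Finset.prod_empty, one_mul]
    have hUe : ∀ x : (Fin 0 → Bool) × Q, x ∈ U ↔ e.symm x ∈ G := fun x => by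
      rw [hes, hU, Fin.foldr_zero]; exact decide_eq_true_iff
    refine ⟨?_, harris_transport e _ hνe hHQ, cert_transport e g1 g2 g3 g4 g5 g6 _ hνe U hUe⟩
    intro x y hxy hx
    simp only [Finset.mem_coe] at hx ⊢
    rw [hUe] at hx ⊢
    exact hG (show e.symm x ≤ e.symm y from (Prod.mk_le_mk.1 hxy).2) hx
  | succ n ih =>
    intro ops w hw ν hν U hU
    -- the tail slot and weight on `(Fin n → Bool) × Q`
    obtain ⟨G', hG'⟩ : ∃ V : Finset ((Fin n → Bool) × Q), ∀ x, x ∈ V ↔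
        Fin.foldr n (fun i b => bif (Fin.tail ops) i then (x.1 i || b) else (x.1 i && b)) (decide (x.2 ∈ G)) = true :=
      ⟨univ.filter fun x => Fin.foldr n (fun i b => bif (Fin.tail ops) i then (x.1 i || b) else (x.1 i && b))
        (decide (x.2 ∈ G)) = true, fun x => by simp⟩
    obtain ⟨ν', hν'⟩ : ∃ f : (Fin n → Bool) × Q → ℝ, ∀ x, f x = (∏ i, w i.succ (x.1 i)) * νQ x.2 := ⟨_, fun _ => rfl⟩
    obtain ⟨hG'up, hH', R', Fl', c1, c2, c3, c4, c5, c6⟩ :=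
      ih (Fin.tail ops) (fun i => w i.succ) (fun i b => hw _ _) ν' hν' G' hG'
    have hν'0 : ∀ x, 0 ≤ ν' x := fun x => by
      rw [hν']; exact mul_nonneg (Finset.prod_nonneg fun i _ => hw _ _) (hνQ _)
    -- the layered weight on `Bool × ((Fin n → Bool) × Q)`
    obtain ⟨ν₂, hν₂⟩ : ∃ f : Bool × ((Fin n → Bool) × Q) → ℝ, ∀ y,
        f y = (if y.1 = true then w 0 true else w 0 false) * ν' y.2 := ⟨_, fun _ => rfl⟩
    have hν₂t : ∀ t, ν₂ (true, t) = w 0 true * ν' t := fun t => by rw [hν₂]; simp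
    have hν₂f : ∀ t, ν₂ (false, t) = w 0 false * ν' t := fun t => by rw [hν₂]; simp
    -- `(Fin (n+1) → Bool) × Q ≃o Bool × ((Fin n → Bool) × Q)`
    let e : (Bool × ((Fin n → Bool) × Q)) ≃o ((Fin (n + 1) → Bool) × Q) :=
      { toFun := fun y => (Fin.cons y.1 y.2.1, y.2.2)
        invFun := fun x => (x.1 0, (Fin.tail x.1, x.2))
        left_inv := fun y => by simp
        right_inv := fun x => by simp
        map_rel_iff' := by
          rintro ⟨b, f, q⟩ ⟨b', f', q'⟩
          simp only [Equiv.coe_fn_mk, Prod.mk_le_mk]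
          rw [Pi.le_def, Fin.forall_iff_succ, Pi.le_def]
          simp only [Fin.cons_zero, Fin.cons_succ]
          tauto }
    have hes : ∀ x : (Fin (n + 1) → Bool) × Q, e.symm x = (x.1 0, (Fin.tail x.1, x.2)) := fun x => rfl
    have hνe : ∀ x : (Fin (n + 1) → Bool) × Q, ν x = ν₂ (e.symm x) := fun x => by
      rw [hes, hν₂, hν, Fin.prod_univ_succ, hν']
      cases x.1 0 <;> simp [Fin.tail, mul_assoc]
    have hH₂ := harris_layers hν'0 hH' (hw 0 true) (hw 0 false) ν₂ hν₂t hν₂f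
    have hev : ∀ x : (Fin (n + 1) → Bool) × Q, x ∈ U ↔ (bif ops 0 then (x.1 0 || decide ((Fin.tail x.1, x.2) ∈ G'))
        else (x.1 0 && decide ((Fin.tail x.1, x.2) ∈ G'))) = true := fun x => by
      rw [hU, Fin.foldr_succ]
      have hd : decide ((Fin.tail x.1, x.2) ∈ G') = Fin.foldr n (fun i b => bif (Fin.tail ops) i then
          (Fin.tail x.1 i || b) else (Fin.tail x.1 i && b)) (decide (x.2 ∈ G)) := by
        by_cases h : (Fin.tail x.1, x.2) ∈ G'
        · rw [decide_eq_true h, ((hG' _).1 h)]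
        · rw [decide_eq_false h]
          rcases Bool.eq_false_or_eq_true (Fin.foldr n (fun i b => bif (Fin.tail ops) i then
            (Fin.tail x.1 i || b) else (Fin.tail x.1 i && b)) (decide (x.2 ∈ G))) with h1 | h1
          · exact absurd ((hG' (Fin.tail x.1, x.2)).2 h1) h
          · rw [h1]
      rw [hd]
      rfl
    cases ho : ops 0
    · -- AND-step
      obtain ⟨U₂, hU₂⟩ : ∃ V : Finset (Bool × ((Fin n → Bool) × Q)), ∀ y, y ∈ V ↔ (y.1 = true ∧ y.2 ∈ G') :=
        ⟨univ.filter fun y => y.1 = true ∧ y.2 ∈ G', fun y => by simp⟩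
      obtain ⟨R₂, Fl₂, d1, d2, d3, d4, d5, d6⟩ := cert_and_step hν'0 hH' G' hG'up
        R' Fl' c1 c2 c3 c4 c5 c6 (hw 0 true) (hw 0 false) ν₂ hν₂t hν₂f U₂ hU₂
      have hUe : ∀ x : (Fin (n + 1) → Bool) × Q, x ∈ U ↔ e.symm x ∈ U₂ := fun x => by
        rw [hev, ho, hes, hU₂]; simp
      refine ⟨?_, harris_transport e _ hνe hH₂, cert_transport e d1 d2 d3 d4 d5 d6 _ hνe U hUe⟩
      intro x y hxy hx
      simp only [Finset.mem_coe] at hx ⊢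
      rw [hUe, hU₂] at hx ⊢
      rw [hes] at hx ⊢
      have hxy' : x.1 ≤ y.1 ∧ x.2 ≤ y.2 := Prod.mk_le_mk.1 (by simpa using hxy)
      refine ⟨?_, hG'up (show ((Fin.tail x.1, x.2) : (Fin n → Bool) × Q) ≤ (Fin.tail y.1, y.2) from
        Prod.mk_le_mk.2 ⟨fun i => hxy'.1 i.succ, hxy'.2⟩) hx.2⟩
      have h0 : x.1 0 ≤ y.1 0 := hxy'.1 0
      have hx0 : x.1 0 = true := hx.1
      rw [hx0] at h0
      exact top_le_iff.mp h0
    · -- OR-step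
      obtain ⟨U₂, hU₂⟩ : ∃ V : Finset (Bool × ((Fin n → Bool) × Q)), ∀ y, y ∈ V ↔ (y.1 = true ∨ y.2 ∈ G') :=
        ⟨univ.filter fun y => y.1 = true ∨ y.2 ∈ G', fun y => by simp⟩
      obtain ⟨R₂, Fl₂, d1, d2, d3, d4, d5, d6⟩ := cert_or_step hν'0 hH' G' hG'up
        R' Fl' c1 c2 c3 c4 c5 c6 (hw 0 true) (hw 0 false) ν₂ hν₂t hν₂f U₂ hU₂
      have hUe : ∀ x : (Fin (n + 1) → Bool) × Q, x ∈ U ↔ e.symm x ∈ U₂ := fun x => by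
        rw [hev, ho, hes, hU₂]; simp
      refine ⟨?_, harris_transport e _ hνe hH₂, cert_transport e d1 d2 d3 d4 d5 d6 _ hνe U hUe⟩
      intro x y hxy hx
      simp only [Finset.mem_coe] at hx ⊢
      rw [hUe, hU₂] at hx ⊢
      rw [hes] at hx ⊢
      have hxy' : x.1 ≤ y.1 ∧ x.2 ≤ y.2 := Prod.mk_le_mk.1 (by simpa using hxy)
      rcases hx with hx0 | hxG
      · left
        have h0 : x.1 0 ≤ y.1 0 := hxy'.1 0
        have hx0' : x.1 0 = true := hx0
        rw [hx0'] at h0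
        exact top_le_iff.mp h0
      · exact Or.inr (hG'up (show ((Fin.tail x.1, x.2) : (Fin n → Bool) × Q) ≤ (Fin.tail y.1, y.2) from
          Prod.mk_le_mk.2 ⟨fun i => hxy'.1 i.succ, hxy'.2⟩) hxG)

end Summit.CriticalPhenomena.PercolationContinuityZ3.Theorems.SahiE3LroOverBase
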